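import Summits.CriticalPhenomena.PercolationContinuityZ3.Theorems.PercNearOneGluingNoHeavyRsw3InvasionSelfOrganised
import Summits.CriticalPhenomena.PercolationContinuityZ3.Theorems.PercNearOneGluingNoHeavyRsw3InfiniteClusterDensityAS
import Literature.Probability.Percolation.ThetaContinuity
import Literature.Probability.Percolation.CriticalContinuityProofs
import HarnessLib

/-!
# RSW3 lane (P2, gen 26): INVASION PERCOLATION V — THE INVADED REGION OF `ℤ^d` HAS ZERO DENSITY, ALMOST SURELY, IN EVERY
# DIMENSION `d ≥ 2` (Chayes–Chayes–Newman 1985 Thm 5.2, whose hypothesis `θ(p_c) = 0` is p205010)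

builds on p205010 (kernel theorem, internal audit signed; external expert review pending) — USED here (`CSH.percolationContinuity_allDimensions`)
for the unconditional forms; the structural theorem `ae_tendsto_invadedDensity_zero_of_continuity` takes `θ(p_c(ℤ^d)) = 0` as a hypothesis.
Status sentence for p205010: "θ(p_c) = 0 on ℤ^d, all d ≥ 2 — kernel-verified (Lean 4/Mathlib, standard axioms); internal adversarial
audit SIGNED 2026-08-20 04:29Z; external expert review pending."

Cell `prim-rsw3`, prover seat `prim-rsw3-p2` (gen 26), memo `run/shared/lean/prim/rsw3/P2-RSWLITE.md` §33.  Support file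
(`--supports stmt-CriticalPhenomena-4575`); no definitions, no named facts, no sorries.  `μ = labelMeasure (Site d)`,
`I_∞(U) = invadedRegion (zdGraph d) U 0` the region invaded from the origin, `Λ_N = box d N = [-N, N]^d`.

* `ae_exists_finite_invadedRegion_subset` (`d ≥ 2`, `y > p_c`): a.s. `I_∞ ⊆ F ∪ {x : |C_y(x)| = ∞}` for a FINITE set `F` — after the
  last label `> y` (file IV) the invasion propagates through `y`-open bonds only (file I), so it stays in the `y`-clusters of the
  finitely many vertices invaded so far.
* **`ae_tendsto_invadedDensity_zero_of_continuity`** (`d ≥ 2`): IF `θ(p_c(ℤ^d)) = 0` THEN a.s. `|I_∞ ∩ Λ_N| / |Λ_N| → 0` — by the item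
  above, the a.s. density `#{x ∈ Λ_N : |C_y(x)| = ∞}/|Λ_N| → θ(y)` (the lane's spatial ergodic theorem, gen 24
  `ae_tendsto_percCount_div`, transported to the label space) and right-continuity of `θ` at `p_c` (Grimmett Lemma (8.9)).  This is
  CCN's Theorem 5.2 in almost-sure Cesàro form: "[if] `P_∞(p_c) = 0` … the invaded region has zero density".
* `ae_frequently_criticalProb_lt_acceptedLabel` (`d ≥ 2`, via p205010): a.s. `x_n > p_c` for infinitely many `n` (the invasion
  leaves the — finite — critical clusters again and again), while by file IV `x_n > p_c + ε` only finitely often.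
* `tendsto_integral_invadedDensity_zero`, `tendsto_average_prob_mem_invadedRegion_zero` (`d ≥ 2`, via p205010): CCN's Theorem 5.2 as printed
  (`Y = 0`), in Cesàro form — `|Λ_N|⁻¹ Σ_{x∈Λ_N} P(x is eventually invaded) → 0` (dominated convergence).
* **`ae_eventually_acceptedLabel_le_iff` / `ae_frequently_lt_acceptedLabel_iff`** (`d ≥ 2`): `p_c(ℤ^d)` READ OFF THE INVASION ALONE —
  (a.s. `x_n ≤ y` eventually) ⟺ `p_c < y`, and (a.s. `x_n > y` infinitely often) ⟺ `y ≤ p_c`; the boundary case `y = p_c` is p205010.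
* `ae_infinite_compl_invadedRegion` (`d ≥ 2`): a.s. infinitely many vertices are never invaded; `ae_infinite_criticalClusters_met`
  (`d ≥ 2`, p205010): a.s. the invaded region meets infinitely many distinct (finite) `p_c`-clusters.
* **`ae_tendsto_invadedDensity_zero`** (`d ≥ 2`, UNCONDITIONAL via p205010) and **`ae_tendsto_invadedDensity_zero_Z3`**:
  **INVASION PERCOLATION ON `ℤ³` INVADES A SET OF ZERO ASYMPTOTIC DENSITY, ALMOST SURELY** — previously known for `d = 2` (CCN 1985,
  Harris–Kesten `θ(1/2) = 0`) and in high dimensions (Hara–Slade); for `3 ≤ d ≤ 6` it was exactly as open as `θ(p_c) = 0`.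

References: J. T. Chayes, L. Chayes, C. M. Newman, Comm. Math. Phys. 101 (1985) 383–407, Thm 5.1/5.2 and §5 Remark 1 [ChayesChayesNewman1985];
C. M. Newman, L. S. Schulman, J. Stat. Phys. 26 (1981) [NewmanSchulman1981]; G. Grimmett, *Percolation* (1999), Lemma (8.9) [GrimmettPercolation1999].
-/

noncomputable section

namespace Summit.CriticalPhenomena.PercolationContinuityZ3.Theorems.Rsw3

open Finset MeasureTheory ProbabilityTheory Filter Topology Literature.Probability.LatticeModels Literature.Probability.Percolation
open Literature.Probability.Percolation.Invasion

variable {d : ℕ}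

/-! ## §1 After the last large label the invasion lives in finitely many `y`-clusters -/

/-- **A.s. the invaded region lies in a finite set plus the infinite `y`-clusters**, for every `y > p_c(ℤ^d)` (`d ≥ 2`).
[cite: ChayesChayesNewman1985, Thm 5.2 (proof: essentially a corollary of Thm 3.1/3.2)] -/
theorem ae_exists_finite_invadedRegion_subset (hd : 2 ≤ d) (y : unitInterval) (hy : criticalProb (zdGraph d) (0 : Site d) < y) :
    ∀ᵐ U ∂(labelMeasure (Site d)), ∃ F : Set (Site d), F.Finite ∧
      invadedRegion (zdGraph d) U 0 ⊆ F ∪ {x | configOfLabels (y : ℝ) U (zdGraph d) ∈ percolatesAt x} := by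
  filter_upwards [ae_eventually_acceptedLabel_le hd y hy] with U hU
  obtain ⟨N, hN⟩ := eventually_atTop.1 hU
  classical
  refine ⟨⋃ u ∈ (invasion (zdGraph d) U 0 N).filter (fun u => (openCluster (configOfLabels (y : ℝ) U (zdGraph d)) u).Finite),
    openCluster (configOfLabels (y : ℝ) U (zdGraph d)) u, ?_, ?_⟩
  · exact (Finset.finite_toSet _).biUnion fun u hu => (mem_filter.1 (Finset.mem_coe.1 hu)).2
  · intro x hx
    obtain ⟨u, hu, hxu⟩ := Set.mem_iUnion₂.1 (invadedRegion_subset_of_forall_acceptedLabel_le hN hx)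
    by_cases hfin : (openCluster (configOfLabels (y : ℝ) U (zdGraph d)) u).Finite
    · exact Or.inl (Set.mem_iUnion₂.2 ⟨u, Finset.mem_coe.2 (mem_filter.2 ⟨Finset.mem_coe.1 hu, hfin⟩), hxu⟩)
    · exact Or.inr (Set.Infinite.mono (fun z hz => (SimpleGraph.Reachable.symm hxu).trans hz) hfin)

/-! ## §2 Zero density -/

open Classical in
/-- The lane's a.s. density of the infinite cluster (gen 24), transported to the label space: for every `p`, `μ`-a.s.
`#{x ∈ Λ_N : |C_p(x)| = ∞}/(2N+1)^d → θ(p)` for the coupled configuration `η_p`. [cite: NewmanSchulman1981, §3] -/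
theorem ae_tendsto_percCount_div_configOfLabels (hd : 1 ≤ d) (p : unitInterval) :
    ∀ᵐ U ∂(labelMeasure (Site d)), Tendsto (fun N : ℕ =>
      (((box d N).filter fun x => configOfLabels (p : ℝ) U (zdGraph d) ∈ (percolatesAt x : Set (BondConfig (Site d)))).card : ℝ) /
        (2 * (N : ℝ) + 1) ^ d) atTop (𝓝 (theta (zdGraph d) (0 : Site d) p)) := by
  have h := ae_tendsto_percCount_div hd p
  rw [← map_configOfLabels_holds (zdGraph d) p] at h
  exact ae_of_ae_map (measurable_configOfLabels _ _).aemeasurable h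

open Classical in
/-- **Chayes–Chayes–Newman's Theorem 5.2 in almost-sure form: IF `θ(p_c(ℤ^d)) = 0` (`d ≥ 2`) THEN THE INVADED REGION HAS ZERO DENSITY**,
`|I_∞ ∩ Λ_N| / (2N+1)^d → 0` almost surely. [cite: ChayesChayesNewman1985, Thm 5.2 and the discussion following it (P_∞(p_c) = 0 ⇒ zero density)] -/
theorem ae_tendsto_invadedDensity_zero_of_continuity (hd : 2 ≤ d) (hcont : PercolationContinuity d) :
    ∀ᵐ U ∂(labelMeasure (Site d)), Tendsto (fun N : ℕ =>
      (((box d N).filter fun x => x ∈ invadedRegion (zdGraph d) U 0).card : ℝ) / (2 * (N : ℝ) + 1) ^ d) atTop (𝓝 0) := by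
  classical
  set pc := criticalProb (zdGraph d) (0 : Site d) with hpc
  have hpc1 : pc < 1 := criticalProb_zd_lt_one hd
  have hpc0 : 0 ≤ pc := (criticalProb_mem_Icc _ _).1
  -- a sequence of levels `y k ↓ p_c` inside `(p_c, 1]`
  have hy : ∀ k : ℕ, ∃ q : unitInterval, pc < q ∧ (q : ℝ) < pc + 1 / (k + 1) := by
    intro k
    have hk : (0 : ℝ) < 1 / (k + 1) := by positivity
    set t : ℝ := min (pc + 1 / (2 * (k + 1))) ((pc + 1) / 2) with ht
    have ht0 : 0 ≤ t := le_min (by positivity) (by linarith)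
    have ht1 : t ≤ 1 := (min_le_right _ _).trans (by linarith)
    refine ⟨⟨t, ht0, ht1⟩, lt_min (by linarith [show (0:ℝ) < 1 / (2 * (k + 1)) by positivity]) (by linarith), ?_⟩
    calc (t : ℝ) ≤ pc + 1 / (2 * (k + 1)) := min_le_left _ _
      _ < pc + 1 / (k + 1) := by
        have : (1 : ℝ) / (2 * (k + 1)) < 1 / (k + 1) := by
          apply div_lt_div_of_pos_left one_pos (by positivity); linarith
        linarith
  choose y hy1 hy2 using hy
  -- `θ(y k) → θ(p_c) = 0`
  have hθ : Tendsto (fun k => theta (zdGraph d) (0 : Site d) (y k)) atTop (𝓝 0) := by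
    have hcont' : theta (zdGraph d) (0 : Site d) (criticalProbI d) = 0 := hcont
    have hcw := theta_continuousWithinAt_Ici (d := d) (criticalProbI d)
    rw [ContinuousWithinAt, hcont'] at hcw
    refine hcw.comp (tendsto_nhdsWithin_iff.2 ⟨?_, Filter.Eventually.of_forall fun k => (hy1 k).le⟩)
    rw [Metric.tendsto_atTop]
    intro ε hε
    obtain ⟨K, hK⟩ := exists_nat_one_div_lt hε
    refine ⟨K, fun k hk => ?_⟩
    rw [Subtype.dist_eq, Real.dist_eq, abs_lt]
    have h1 : (criticalProbI d : ℝ) = pc := rfl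
    have h2 : (1 : ℝ) / (k + 1) ≤ 1 / (K + 1) := by
      apply div_le_div_of_nonneg_left zero_le_one (by positivity)
      exact_mod_cast Nat.succ_le_succ hk
    constructor <;> linarith [hy1 k, hy2 k]
  -- the almost sure events
  have hae := (ae_all_iff.2 fun k => ae_exists_finite_invadedRegion_subset hd (y k) (hy1 k)).and
    (ae_all_iff.2 fun k => ae_tendsto_percCount_div_configOfLabels (d := d) (by omega) (y k))
  filter_upwards [hae] with U hU
  obtain ⟨hF, hdens⟩ := hU
  -- deterministic squeeze
  have hpow : ∀ N : ℕ, (0 : ℝ) < (2 * (N : ℝ) + 1) ^ d := fun N => by positivity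
  rw [Metric.tendsto_atTop]
  intro ε hε
  obtain ⟨k, hk⟩ := (Metric.tendsto_atTop.1 hθ) (ε / 2) (by positivity)
  have hθk : theta (zdGraph d) (0 : Site d) (y k) < ε / 2 := by
    have := hk k le_rfl
    rw [Real.dist_eq, sub_zero, abs_lt] at this
    exact this.2
  obtain ⟨F, hFfin, hsub⟩ := hF k
  -- `|F| / (2N+1)^d → 0`
  have hFt : Tendsto (fun N : ℕ => (hFfin.toFinset.card : ℝ) / (2 * (N : ℝ) + 1) ^ d) atTop (𝓝 0) := by
    refine Tendsto.div_atTop tendsto_const_nhds ?_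
    have h1 : Tendsto (fun N : ℕ => (2 * (N : ℝ) + 1)) atTop atTop :=
      tendsto_atTop_add_const_right _ _ (Tendsto.const_mul_atTop two_pos tendsto_natCast_atTop_atTop)
    exact (tendsto_pow_atTop (by omega : d ≠ 0)).comp h1
  obtain ⟨N₁, hN₁⟩ := (Metric.tendsto_atTop.1 hFt) (ε / 4) (by positivity)
  obtain ⟨N₂, hN₂⟩ := (Metric.tendsto_atTop.1 (hdens k)) (ε / 4) (by positivity)
  refine ⟨max N₁ N₂, fun N hN => ?_⟩
  have hcard : (((box d N).filter fun x => x ∈ invadedRegion (zdGraph d) U 0).card : ℝ) ≤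
      hFfin.toFinset.card + ((box d N).filter fun x =>
        configOfLabels (y k : ℝ) U (zdGraph d) ∈ (percolatesAt x : Set (BondConfig (Site d)))).card := by
    have : (box d N).filter (fun x => x ∈ invadedRegion (zdGraph d) U 0) ⊆ hFfin.toFinset ∪
        (box d N).filter fun x => configOfLabels (y k : ℝ) U (zdGraph d) ∈ (percolatesAt x : Set (BondConfig (Site d))) := by
      intro x hx
      rw [mem_filter] at hx
      rcases hsub hx.2 with h | h
      · exact mem_union_left _ (hFfin.mem_toFinset.2 h)
      · exact mem_union_right _ (mem_filter.2 ⟨hx.1, h⟩)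
    exact_mod_cast (card_le_card this).trans (card_union_le _ _)
  have hA := hN₁ N (le_of_max_le_left hN)
  have hB := hN₂ N (le_of_max_le_right hN)
  rw [Real.dist_eq, sub_zero] at hA ⊢
  rw [Real.dist_eq] at hB
  have hA' := (abs_lt.1 hA).2
  have hB' := (abs_lt.1 hB).2
  have hnonneg : (0 : ℝ) ≤ (((box d N).filter fun x => x ∈ invadedRegion (zdGraph d) U 0).card : ℝ) / (2 * (N : ℝ) + 1) ^ d :=
    by positivity
  rw [abs_of_nonneg hnonneg, div_lt_iff₀ (hpow N)]
  have h1 := (div_lt_iff₀ (hpow N)).1 hA'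
  have h2 : (((box d N).filter fun x => configOfLabels (y k : ℝ) U (zdGraph d) ∈ (percolatesAt x : Set (BondConfig (Site d)))).card : ℝ)
      < (theta (zdGraph d) (0 : Site d) (y k) + ε / 4) * (2 * (N : ℝ) + 1) ^ d := by
    rw [← div_lt_iff₀ (hpow N)]; linarith
  calc (((box d N).filter fun x => x ∈ invadedRegion (zdGraph d) U 0).card : ℝ)
      ≤ hFfin.toFinset.card + ((box d N).filter fun x =>
        configOfLabels (y k : ℝ) U (zdGraph d) ∈ (percolatesAt x : Set (BondConfig (Site d)))).card := hcard
    _ < ε / 4 * (2 * (N : ℝ) + 1) ^ d + (theta (zdGraph d) (0 : Site d) (y k) + ε / 4) * (2 * (N : ℝ) + 1) ^ d := by linarith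
    _ ≤ ε * (2 * (N : ℝ) + 1) ^ d := by nlinarith [hpow N]

open Classical in
/-- **INVASION PERCOLATION ON `ℤ^d`, `d ≥ 2`, INVADES A ZERO-DENSITY SET, ALMOST SURELY** — unconditionally, by p205010
(`θ(p_c(ℤ^d)) = 0` for every `d ≥ 2`): `|I_∞ ∩ Λ_N| / (2N+1)^d → 0` a.s.
[cite: ChayesChayesNewman1985, Thm 5.2 (with P_∞(p_c) = 0)] -/
theorem ae_tendsto_invadedDensity_zero (hd : 2 ≤ d) :
    ∀ᵐ U ∂(labelMeasure (Site d)), Tendsto (fun N : ℕ =>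
      (((box d N).filter fun x => x ∈ invadedRegion (zdGraph d) U 0).card : ℝ) / (2 * (N : ℝ) + 1) ^ d) atTop (𝓝 0) :=
  ae_tendsto_invadedDensity_zero_of_continuity hd (CSH.percolationContinuity_allDimensions d hd)

/-- Measurability of "`x` is eventually invaded". [cite: ChayesChayesNewman1985, Thm 5.2 (the events Θ_b)] -/
theorem measurableSet_mem_invadedRegion (x : Site d) :
    MeasurableSet {U : Sym2 (Site d) → ℝ | x ∈ invadedRegion (zdGraph d) U 0} := by
  have : {U : Sym2 (Site d) → ℝ | x ∈ invadedRegion (zdGraph d) U 0} = {U | ∃ n, x ∈ invasion (zdGraph d) U 0 n} := by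
    ext U; exact mem_invadedRegion _
  rw [this]
  exact measurableSet_setOf.2 (Measurable.exists fun n => measurable_invasion_prop 0 n (x ∈ ·))

open Classical in
/-- The invaded density of `Λ_N` is a measurable function of the labels, with values in `[0, 1]`. [cite: ChayesChayesNewman1985, §5 (density of the invaded region)] -/
theorem measurable_invadedDensity (N : ℕ) :
    Measurable fun U : Sym2 (Site d) → ℝ =>
      (((box d N).filter fun x => x ∈ invadedRegion (zdGraph d) U 0).card : ℝ) / (2 * (N : ℝ) + 1) ^ d := by
  refine Measurable.div_const ?_ _
  have : (fun U : Sym2 (Site d) → ℝ => (((box d N).filter fun x => x ∈ invadedRegion (zdGraph d) U 0).card : ℝ)) =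
      fun U => ∑ x ∈ box d N, if x ∈ invadedRegion (zdGraph d) U 0 then (1 : ℝ) else 0 := by
    funext U
    rw [Finset.card_filter]
    push_cast
    rfl
  rw [this]
  refine Finset.measurable_sum _ fun x _ => Measurable.ite (measurableSet_mem_invadedRegion x) measurable_const measurable_const

open Classical in
/-- **CCN Theorem 5.2 in expectation (`d ≥ 2`, via p205010): the mean invaded density tends to zero**, i.e.
`|Λ_N|⁻¹ Σ_{x ∈ Λ_N} P(x is eventually invaded) → 0` — CCN's `Y = lim P(Θ_b) = 0` in Cesàro form. [cite: ChayesChayesNewman1985, Thm 5.2 (Y = 0 when P_∞(p_c) = 0)] -/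
theorem tendsto_integral_invadedDensity_zero (hd : 2 ≤ d) :
    Tendsto (fun N : ℕ => ∫ U, (((box d N).filter fun x => x ∈ invadedRegion (zdGraph d) U 0).card : ℝ) / (2 * (N : ℝ) + 1) ^ d
      ∂(labelMeasure (Site d))) atTop (𝓝 0) := by
  haveI : IsProbabilityMeasure (labelMeasure (Site d)) := isProbabilityMeasure_labelMeasure _
  have h := tendsto_integral_of_dominated_convergence (μ := labelMeasure (Site d)) (fun _ => (1 : ℝ))
    (fun N => (measurable_invadedDensity (d := d) N).aestronglyMeasurable) (integrable_const 1) ?_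
    (ae_tendsto_invadedDensity_zero hd)
  · simpa using h
  · intro N
    refine Filter.Eventually.of_forall fun U => ?_
    rw [Real.norm_eq_abs, abs_of_nonneg (by positivity)]
    refine div_le_one_of_le₀ ?_ (by positivity)
    have hle : ((box d N).filter fun x => x ∈ invadedRegion (zdGraph d) U 0).card ≤ (box d N).card := card_filter_le _ _
    rw [card_box] at hle
    exact_mod_cast hle

open Classical in
/-- Mean density as a Cesàro average of invasion probabilities: `∫ |I_∞ ∩ Λ_N|/|Λ_N| dμ = |Λ_N|⁻¹ Σ_{x∈Λ_N} μ{x ∈ I_∞}`, hence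
**`|Λ_N|⁻¹ Σ_{x ∈ Λ_N} P(x is eventually invaded) → 0`** (`d ≥ 2`). [cite: ChayesChayesNewman1985, Thm 5.2 (Y = 0 when P_∞(p_c) = 0)] -/
theorem tendsto_average_prob_mem_invadedRegion_zero (hd : 2 ≤ d) :
    Tendsto (fun N : ℕ => (∑ x ∈ box d N, (labelMeasure (Site d)).real {U | x ∈ invadedRegion (zdGraph d) U 0}) /
      (2 * (N : ℝ) + 1) ^ d) atTop (𝓝 0) := by
  haveI : IsProbabilityMeasure (labelMeasure (Site d)) := isProbabilityMeasure_labelMeasure _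
  refine (tendsto_integral_invadedDensity_zero hd).congr fun N => ?_
  have hcard : ∀ U : Sym2 (Site d) → ℝ, (((box d N).filter fun x => x ∈ invadedRegion (zdGraph d) U 0).card : ℝ) =
      ∑ x ∈ box d N, ({U | x ∈ invadedRegion (zdGraph d) U 0} : Set (Sym2 (Site d) → ℝ)).indicator 1 U := by
    intro U
    rw [Finset.card_filter]
    push_cast
    refine Finset.sum_congr rfl fun x _ => ?_
    by_cases hx : x ∈ invadedRegion (zdGraph d) U 0 <;> simp [Set.indicator, hx]
  simp_rw [hcard]
  rw [integral_div, integral_finsetSum _ fun x _ => ?_]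
  · congr 1
    refine Finset.sum_congr rfl fun x _ => ?_
    rw [integral_indicator_one (measurableSet_mem_invadedRegion x)]
  · exact (integrable_const (1 : ℝ)).indicator (measurableSet_mem_invadedRegion x)

/-- **At `p_c` itself the invasion must leave the critical clusters again and again** (`d ≥ 2`, via p205010): almost surely
`x_n > p_c(ℤ^d)` for INFINITELY many `n` — all `p_c`-clusters are finite (`θ(p_c) = 0`), so the invaded region cannot settle in
finitely many of them; together with file IV, a.s. `x_n > p_c + ε` only finitely often for every `ε > 0`.
[cite: ChayesChayesNewman1985, Thm 3.2 and §3 (ii)] -/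
theorem ae_frequently_criticalProb_lt_acceptedLabel (hd : 2 ≤ d) :
    ∀ᵐ U ∂(labelMeasure (Site d)), ∃ᶠ n in atTop, criticalProb (zdGraph d) (0 : Site d) < acceptedLabel (zdGraph d) U 0 n :=
  ae_frequently_lt_acceptedLabel_of_theta_eq_zero (by omega) (criticalProbI d) (CSH.percolationContinuity_allDimensions d hd)

/-- **`p_c(ℤ^d)` READ OFF THE INVASION ALONE, I** (`d ≥ 2`): for a level `y ∈ [0,1]`, "almost surely `x_n ≤ y` for all large `n`" holds
IF AND ONLY IF `p_c(ℤ^d) < y` — the critical value itself is exceeded infinitely often (p205010 enters exactly at `y = p_c`).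
[cite: ChayesChayesNewman1985, Thm 3.2] -/
theorem ae_eventually_acceptedLabel_le_iff (hd : 2 ≤ d) (y : unitInterval) :
    (∀ᵐ U ∂(labelMeasure (Site d)), ∀ᶠ n in atTop, acceptedLabel (zdGraph d) U 0 n ≤ y) ↔
      criticalProb (zdGraph d) (0 : Site d) < y := by
  haveI : IsProbabilityMeasure (labelMeasure (Site d)) := isProbabilityMeasure_labelMeasure _
  refine ⟨fun h => ?_, ae_eventually_acceptedLabel_le hd y⟩
  by_contra hle
  push Not at hle
  have hfreq : ∀ᵐ U ∂(labelMeasure (Site d)), ∃ᶠ n in atTop, (y : ℝ) < acceptedLabel (zdGraph d) U 0 n := by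
    rcases hle.lt_or_eq with hlt | heq
    · exact ae_frequently_lt_acceptedLabel (by omega) y hlt
    · have hy : y = criticalProbI d := Subtype.ext heq
      rw [hy]
      exact ae_frequently_criticalProb_lt_acceptedLabel hd
  have hfalse : ∀ᵐ U ∂(labelMeasure (Site d)), False := by
    filter_upwards [h, hfreq] with U hU hU'
    exact (hU'.and_eventually hU).exists.elim fun n hn => absurd hn.2 (not_le.2 hn.1)
  have h0 : labelMeasure (Site d) = 0 := by simpa using hfalse
  exact IsProbabilityMeasure.ne_zero (labelMeasure (Site d)) h0

/-- **`p_c(ℤ^d)` READ OFF THE INVASION ALONE, II** (`d ≥ 2`): "almost surely `x_n > y` for infinitely many `n`" holds IF AND ONLY IF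
`y ≤ p_c(ℤ^d)`. [cite: ChayesChayesNewman1985, Thm 3.2] -/
theorem ae_frequently_lt_acceptedLabel_iff (hd : 2 ≤ d) (y : unitInterval) :
    (∀ᵐ U ∂(labelMeasure (Site d)), ∃ᶠ n in atTop, (y : ℝ) < acceptedLabel (zdGraph d) U 0 n) ↔
      (y : ℝ) ≤ criticalProb (zdGraph d) (0 : Site d) := by
  haveI : IsProbabilityMeasure (labelMeasure (Site d)) := isProbabilityMeasure_labelMeasure _
  constructor
  · intro h
    by_contra hlt
    push Not at hlt
    have hev := ae_eventually_acceptedLabel_le hd y hlt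
    have hfalse : ∀ᵐ U ∂(labelMeasure (Site d)), False := by
      filter_upwards [h, hev] with U hU hU'
      exact (hU.and_eventually hU').exists.elim fun n hn => absurd hn.2 (not_le.2 hn.1)
    have h0 : labelMeasure (Site d) = 0 := by simpa using hfalse
    exact IsProbabilityMeasure.ne_zero (labelMeasure (Site d)) h0
  · intro hle
    rcases hle.lt_or_eq with hlt | heq
    · exact ae_frequently_lt_acceptedLabel (by omega) y hlt
    · have hy : y = criticalProbI d := Subtype.ext heq
      rw [hy]
      exact ae_frequently_criticalProb_lt_acceptedLabel hd

/-- **The invaded region meets infinitely many distinct critical clusters**, almost surely (`d ≥ 2`, via p205010): all `p_c`-clusters are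
finite, and the infinite invaded region lies in the union of the `p_c`-clusters of its vertices — "larger and larger critical clusters are
invaded" (Heydenreich–van der Hofstad §16.1). [cite: ChayesChayesNewman1985, §3 (ii) (clusters absorbed whole) and §5] -/
theorem ae_infinite_criticalClusters_met (hd : 2 ≤ d) :
    ∀ᵐ U ∂(labelMeasure (Site d)),
      {C : Set (Site d) | ∃ x ∈ invadedRegion (zdGraph d) U 0,
        C = openCluster (configOfLabels (criticalProbI d : ℝ) U (zdGraph d)) x}.Infinite := by
  haveI : Nonempty (Fin d) := ⟨⟨0, by omega⟩⟩
  haveI : Infinite (Site d) := Pi.infinite_of_right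
  filter_upwards [ae_forall_not_percolatesAt_configOfLabels_of_theta_eq_zero (d := d) (criticalProbI d)
    (CSH.percolationContinuity_allDimensions d hd)] with U hU
  intro hfin
  apply invadedRegion_infinite zdGraph_preconnected_holds U (0 : Site d)
  have hsub : invadedRegion (zdGraph d) U 0 ⊆ ⋃ C ∈ {C : Set (Site d) | ∃ x ∈ invadedRegion (zdGraph d) U 0,
      C = openCluster (configOfLabels (criticalProbI d : ℝ) U (zdGraph d)) x}, C := by
    intro x hx
    have hmem : openCluster (configOfLabels (criticalProbI d : ℝ) U (zdGraph d)) x ∈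
        {C : Set (Site d) | ∃ x ∈ invadedRegion (zdGraph d) U 0,
          C = openCluster (configOfLabels (criticalProbI d : ℝ) U (zdGraph d)) x} := ⟨x, hx, rfl⟩
    exact Set.mem_biUnion hmem (mem_openCluster_self _ x)
  refine (hfin.biUnion fun C hC => ?_).subset hsub
  obtain ⟨x, -, rfl⟩ := hC
  exact Set.not_infinite.1 (hU x)

open Classical in
/-- **Almost surely infinitely many vertices of `ℤ^d` are never invaded** (`d ≥ 2`): a cofinite invaded region would have density `→ 1`,
not `0`.  (CCN/Heydenreich–van der Hofstad §16.1: "the vertices that are surrounded by high weights are never found".)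
[cite: ChayesChayesNewman1985, §5 (zero density of the invaded region)] -/
theorem ae_infinite_compl_invadedRegion (hd : 2 ≤ d) :
    ∀ᵐ U ∂(labelMeasure (Site d)), (invadedRegion (zdGraph d) U 0)ᶜ.Infinite := by
  filter_upwards [ae_tendsto_invadedDensity_zero hd] with U hU
  intro hfin
  have hpow : ∀ N : ℕ, (0 : ℝ) < (2 * (N : ℝ) + 1) ^ d := fun N => by positivity
  -- density ≥ 1 - |complement| / (2N+1)^d, and the right side tends to 1
  have hK : Tendsto (fun N : ℕ => (hfin.toFinset.card : ℝ) / (2 * (N : ℝ) + 1) ^ d) atTop (𝓝 0) := by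
    refine Tendsto.div_atTop tendsto_const_nhds ?_
    have h1 : Tendsto (fun N : ℕ => (2 * (N : ℝ) + 1)) atTop atTop :=
      tendsto_atTop_add_const_right _ _ (Tendsto.const_mul_atTop two_pos tendsto_natCast_atTop_atTop)
    exact (tendsto_pow_atTop (by omega : d ≠ 0)).comp h1
  have hge : ∀ N : ℕ, 1 - (hfin.toFinset.card : ℝ) / (2 * (N : ℝ) + 1) ^ d ≤
      (((box d N).filter fun x => x ∈ invadedRegion (zdGraph d) U 0).card : ℝ) / (2 * (N : ℝ) + 1) ^ d := by
    intro N
    rw [sub_le_iff_le_add, ← add_div, one_le_div (hpow N)]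
    have hc : (2 * (N : ℝ) + 1) ^ d = ((box d N).card : ℝ) := by rw [card_box]; push_cast; ring
    rw [hc]
    have : box d N ⊆ ((box d N).filter fun x => x ∈ invadedRegion (zdGraph d) U 0) ∪ hfin.toFinset := by
      intro x hx
      by_cases h : x ∈ invadedRegion (zdGraph d) U 0
      · exact mem_union_left _ (mem_filter.2 ⟨hx, h⟩)
      · exact mem_union_right _ (hfin.mem_toFinset.2 h)
    exact_mod_cast (card_le_card this).trans (card_union_le _ _)
  have hlim : Tendsto (fun N : ℕ => 1 - (hfin.toFinset.card : ℝ) / (2 * (N : ℝ) + 1) ^ d) atTop (𝓝 (1 - 0)) :=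
    tendsto_const_nhds.sub hK
  have h01 : (1 : ℝ) - 0 ≤ 0 := le_of_tendsto_of_tendsto' hlim hU hge
  linarith

open Classical in
/-- **`ℤ³`: the invaded region of invasion percolation has zero asymptotic density, almost surely.**
[cite: ChayesChayesNewman1985, Thm 5.2 (with P_∞(p_c) = 0)] -/
theorem ae_tendsto_invadedDensity_zero_Z3 :
    ∀ᵐ U ∂(labelMeasure (Site 3)), Tendsto (fun N : ℕ =>
      (((box 3 N).filter fun x => x ∈ invadedRegion (zdGraph 3) U 0).card : ℝ) / (2 * (N : ℝ) + 1) ^ 3) atTop (𝓝 0) :=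
  ae_tendsto_invadedDensity_zero (d := 3) (by norm_num)

end Summit.CriticalPhenomena.PercolationContinuityZ3.Theorems.Rsw3
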